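import Literature.AnabelianGeometry.SemiGraphs.TemperedCompactInVerticialAtOfDisplacementBounds
import Literature.AnabelianGeometry.SemiGraphs.TemperedCompactInVerticialFinite
import HarnessLib

/-!
# [SemiAnbd] Thm. 3.7 (iii) / Cor. 3.9 at a countable `𝒢` modulo ONLY the «no escape» bounds

Mochizuki, *Semi-graphs of anabelioids*, Publ. RIMS **42** (2006), §3, Theorem 3.7 (iii) pp. 40–41 and
Corollary 3.9 p. 42 [cite: MochizukiSemiAnbd2006, Thm 3.7(iii) pp.40-41].

PROOF-ONLY (cell abc-iut, layer L3, GAP row G-t6g3-2; seat abc-iut-L3-t10, integrator; no definition).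
`compactInVerticialAt_of_displacement_bounds` (`TemperedCompactInVerticialAtOfDisplacementBounds.lean`)
left three binders: the compact-form branch-level identification (I4′)_cpt at the orbit-graph levels of
the Galois tower (`stabC`) and the two metric «no escape» bounds (`hdisp`, `hbdd`).  The first is now a
THEOREM of the tree for every countable `𝒢` satisfying the hypotheses of Thm. 3.7 — abc-iut-L3-t8's
`stabBranchPairCpt'_temperedPiChart` (`TemperedCompactInVerticialFinite.lean`; abc-iut-L3-t11's
`stabBranchPairCpt'_ofTower` with (I0c) and abc-iut-L3-t6's (I0v) `galoisLevelData_faithfulV`; no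
finiteness of `𝒢` enters) — so it is discharged here:

* `hadj_temperedPiChart_of_bounded_dist'` — the adjacency clause of (FIX∞) at the canonical data for
  pairs at bounded distance, hypothesis-free but for `Thm37Hypotheses`;
* `compactInVerticialAt_of_noEscape` — `CompactInVerticialAt 𝒢` from `hdisp` (every nontrivial compact
  `C` has a compatible base system along which its elements have bounded displacement) and `hbdd`
  (compatible `C`-fixed vertex systems stay at bounded distance);
* `cor39UpToTwistAt_of_noEscape` — Corollary 3.9 up to twist at a pair, from the same two bounds at
  both graphs.

At finite `𝔾` both bounds are theorems (`compactInVerticialAt_of_finiteGraph` makes every compact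
subgroup verticial, so displacement `0` along its own fixed system and distance `≤ 4` for fixed pairs by
`adjacent_of_hstar`); at infinite countable `𝔾` they are the open sub-row G-t6g3-2b of the cell
(abc-iut-L3-t10's memo `SHAPES-Ggt6g32.md` §(f)); the test semi-graph `𝒢⋆` of abc-iut-w4-d075 satisfies
both desk-side.  No kernel claim is made about them.

Nothing here takes a side on [IUTchIII] Cor. 3.12.
-/

namespace Literature.AnabelianGeometry.SemiGraphs

namespace ProfiniteSemiGraph

open CategoryTheory Topology

universe u

variable {𝒢 : ProfiniteSemiGraph.{u}}

/-- **The adjacency clause of (FIX∞) at the canonical tower, bounded case, hypothesis-free** ([SemiAnbd]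
Thm. 3.7 (iii), p. 41): for `𝒢` satisfying the hypotheses of Thm. 3.7 (countable, not necessarily finite),
a nontrivial compact `C ≤ π₁^temp(𝒢)` and two compatible `C`-fixed vertex systems of the trees `𝔾̃_n` at
bounded subdivision distance, the two vertices are joined by a `C`-fixed edge at every level where they
differ — `hadj_temperedPiChart_of_bounded_dist` with its (I4′)_cpt binder discharged by
`stabBranchPairCpt'_temperedPiChart` ∘ `galoisLevelData_faithfulV`.
[cite: MochizukiSemiAnbd2006, Thm 3.7(iii) p.41] -/
theorem hadj_temperedPiChart_of_bounded_dist' (h37 : 𝒢.Thm37Hypotheses)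
    (C : Subgroup (𝒢.temperedPiChart h37.toProp36Hypotheses).G) (hCcpt : IsCompact (C : Set (𝒢.temperedPiChart h37.toProp36Hypotheses).G)) (hC : C ≠ ⊥)
    (x x' : ∀ j, ((verticialLevelData_temperedPiChart (h36 := h37.toProp36Hypotheses)).tree j).Vertex)
    (hx : ∀ ⦃i j : ℕ⦄ (hij : i ≤ j), ((verticialLevelData_temperedPiChart (h36 := h37.toProp36Hypotheses)).trans hij).vertexMap (x j) = x i)
    (hx' : ∀ ⦃i j : ℕ⦄ (hij : i ≤ j), ((verticialLevelData_temperedPiChart (h36 := h37.toProp36Hypotheses)).trans hij).vertexMap (x' j) = x' i)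
    (hfx : ∀ g ∈ C, ∀ j, ((verticialLevelData_temperedPiChart (h36 := h37.toProp36Hypotheses)).act j g).hom.vertexMap (x j) = x j)
    (hfx' : ∀ g ∈ C, ∀ j, ((verticialLevelData_temperedPiChart (h36 := h37.toProp36Hypotheses)).act j g).hom.vertexMap (x' j) = x' j)
    (hbdd : ∃ N : ℕ, ∀ j, ((verticialLevelData_temperedPiChart (h36 := h37.toProp36Hypotheses)).tree j).subdivision.dist (Sum.inl (x j)) (Sum.inl (x' j)) ≤ N)
    (j : ℕ) (hne : x j ≠ x' j) :
    ∃ (e : ((verticialLevelData_temperedPiChart (h36 := h37.toProp36Hypotheses)).tree j).Edge) (b b' : ((verticialLevelData_temperedPiChart (h36 := h37.toProp36Hypotheses)).tree j).Branch), b ≠ b' ∧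
      ((verticialLevelData_temperedPiChart (h36 := h37.toProp36Hypotheses)).tree j).edgeOf b = e ∧ ((verticialLevelData_temperedPiChart (h36 := h37.toProp36Hypotheses)).tree j).edgeOf b' = e ∧
      ((verticialLevelData_temperedPiChart (h36 := h37.toProp36Hypotheses)).tree j).abuts b = some (x j) ∧ ((verticialLevelData_temperedPiChart (h36 := h37.toProp36Hypotheses)).tree j).abuts b' = some (x' j) ∧
      ∀ g ∈ C, ((verticialLevelData_temperedPiChart (h36 := h37.toProp36Hypotheses)).act j g).hom.edgeMap e = e :=
  hadj_temperedPiChart_of_bounded_dist h37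
    (fun C hC => 𝒢.stabBranchPairCpt'_temperedPiChart h37.toProp36Hypotheses (galoisLevelData_faithfulV 𝒢 h37) C hC)
    C hCcpt hC x x' hx hx' hfx hfx' hbdd j hne

/-- **Theorem 3.7 (iii) AT a countable `𝒢` modulo only the «no escape» bounds** ([SemiAnbd]
pp. 40–41): if every nontrivial compact subgroup of the constructed `π₁^temp(𝒢)` has a compatible base
system of tree vertices along which its elements have bounded displacement (`hdisp`), and any two
compatible vertex systems fixed by it stay at bounded distance (`hbdd`), then `CompactInVerticialAt 𝒢` —
every chart, no finiteness of `𝒢`. [cite: MochizukiSemiAnbd2006, Thm 3.7(iii) pp.40-41] -/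
theorem compactInVerticialAt_of_noEscape (h37 : 𝒢.Thm37Hypotheses)
    (hdisp : ∀ (C : Subgroup (𝒢.temperedPiChart h37.toProp36Hypotheses).G), IsCompact (C : Set (𝒢.temperedPiChart h37.toProp36Hypotheses).G) → C ≠ ⊥ →
      ∃ x : ∀ j, ((verticialLevelData_temperedPiChart (h36 := h37.toProp36Hypotheses)).tree j).Vertex,
        (∀ ⦃i j : ℕ⦄ (hij : i ≤ j), ((verticialLevelData_temperedPiChart (h36 := h37.toProp36Hypotheses)).trans hij).vertexMap (x j) = x i) ∧
        ∀ g ∈ C, ∃ N : ℕ, ∀ j, ((verticialLevelData_temperedPiChart (h36 := h37.toProp36Hypotheses)).tree j).subdivision.dist (Sum.inl (x j))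
          (Sum.inl (((verticialLevelData_temperedPiChart (h36 := h37.toProp36Hypotheses)).act j g).hom.vertexMap (x j))) ≤ N)
    (hbdd : ∀ (C : Subgroup (𝒢.temperedPiChart h37.toProp36Hypotheses).G), IsCompact (C : Set (𝒢.temperedPiChart h37.toProp36Hypotheses).G) → C ≠ ⊥ →
      ∀ x x' : ∀ j, ((verticialLevelData_temperedPiChart (h36 := h37.toProp36Hypotheses)).tree j).Vertex,
      (∀ ⦃i j : ℕ⦄ (hij : i ≤ j), ((verticialLevelData_temperedPiChart (h36 := h37.toProp36Hypotheses)).trans hij).vertexMap (x j) = x i) →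
      (∀ ⦃i j : ℕ⦄ (hij : i ≤ j), ((verticialLevelData_temperedPiChart (h36 := h37.toProp36Hypotheses)).trans hij).vertexMap (x' j) = x' i) →
      (∀ g ∈ C, ∀ j, ((verticialLevelData_temperedPiChart (h36 := h37.toProp36Hypotheses)).act j g).hom.vertexMap (x j) = x j) →
      (∀ g ∈ C, ∀ j, ((verticialLevelData_temperedPiChart (h36 := h37.toProp36Hypotheses)).act j g).hom.vertexMap (x' j) = x' j) →
      ∃ N : ℕ, ∀ j, ((verticialLevelData_temperedPiChart (h36 := h37.toProp36Hypotheses)).tree j).subdivision.dist (Sum.inl (x j)) (Sum.inl (x' j)) ≤ N) :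
    CompactInVerticialAt 𝒢 :=
  compactInVerticialAt_of_displacement_bounds h37
    (fun C hC => 𝒢.stabBranchPairCpt'_temperedPiChart h37.toProp36Hypotheses (galoisLevelData_faithfulV 𝒢 h37) C hC)
    hdisp hbdd

/-- **Corollary 3.9 (up to twist) for a pair of countable graphs of anabelioids modulo only the «no
escape» bounds at both** ([SemiAnbd] p. 42). [cite: MochizukiSemiAnbd2006, Cor 3.9 p.42] -/
theorem cor39UpToTwistAt_of_noEscape {ℋ : ProfiniteSemiGraph.{u}}
    (h37𝒢 : 𝒢.Thm37Hypotheses) (h37ℋ : ℋ.Thm37Hypotheses)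
    (hdisp𝒢 : ∀ (C : Subgroup (𝒢.temperedPiChart h37𝒢.toProp36Hypotheses).G), IsCompact (C : Set (𝒢.temperedPiChart h37𝒢.toProp36Hypotheses).G) → C ≠ ⊥ →
      ∃ x : ∀ j, ((verticialLevelData_temperedPiChart (h36 := h37𝒢.toProp36Hypotheses)).tree j).Vertex,
        (∀ ⦃i j : ℕ⦄ (hij : i ≤ j), ((verticialLevelData_temperedPiChart (h36 := h37𝒢.toProp36Hypotheses)).trans hij).vertexMap (x j) = x i) ∧
        ∀ g ∈ C, ∃ N : ℕ, ∀ j, ((verticialLevelData_temperedPiChart (h36 := h37𝒢.toProp36Hypotheses)).tree j).subdivision.dist (Sum.inl (x j))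
          (Sum.inl (((verticialLevelData_temperedPiChart (h36 := h37𝒢.toProp36Hypotheses)).act j g).hom.vertexMap (x j))) ≤ N)
    (hbdd𝒢 : ∀ (C : Subgroup (𝒢.temperedPiChart h37𝒢.toProp36Hypotheses).G), IsCompact (C : Set (𝒢.temperedPiChart h37𝒢.toProp36Hypotheses).G) → C ≠ ⊥ →
      ∀ x x' : ∀ j, ((verticialLevelData_temperedPiChart (h36 := h37𝒢.toProp36Hypotheses)).tree j).Vertex,
      (∀ ⦃i j : ℕ⦄ (hij : i ≤ j), ((verticialLevelData_temperedPiChart (h36 := h37𝒢.toProp36Hypotheses)).trans hij).vertexMap (x j) = x i) →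
      (∀ ⦃i j : ℕ⦄ (hij : i ≤ j), ((verticialLevelData_temperedPiChart (h36 := h37𝒢.toProp36Hypotheses)).trans hij).vertexMap (x' j) = x' i) →
      (∀ g ∈ C, ∀ j, ((verticialLevelData_temperedPiChart (h36 := h37𝒢.toProp36Hypotheses)).act j g).hom.vertexMap (x j) = x j) →
      (∀ g ∈ C, ∀ j, ((verticialLevelData_temperedPiChart (h36 := h37𝒢.toProp36Hypotheses)).act j g).hom.vertexMap (x' j) = x' j) →
      ∃ N : ℕ, ∀ j, ((verticialLevelData_temperedPiChart (h36 := h37𝒢.toProp36Hypotheses)).tree j).subdivision.dist (Sum.inl (x j)) (Sum.inl (x' j)) ≤ N)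
    (hdispℋ : ∀ (C : Subgroup (ℋ.temperedPiChart h37ℋ.toProp36Hypotheses).G), IsCompact (C : Set (ℋ.temperedPiChart h37ℋ.toProp36Hypotheses).G) → C ≠ ⊥ →
      ∃ x : ∀ j, ((verticialLevelData_temperedPiChart (𝒢 := ℋ) (h36 := h37ℋ.toProp36Hypotheses)).tree j).Vertex,
        (∀ ⦃i j : ℕ⦄ (hij : i ≤ j), ((verticialLevelData_temperedPiChart (𝒢 := ℋ) (h36 := h37ℋ.toProp36Hypotheses)).trans hij).vertexMap (x j) = x i) ∧
        ∀ g ∈ C, ∃ N : ℕ, ∀ j, ((verticialLevelData_temperedPiChart (𝒢 := ℋ) (h36 := h37ℋ.toProp36Hypotheses)).tree j).subdivision.dist (Sum.inl (x j))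
          (Sum.inl (((verticialLevelData_temperedPiChart (𝒢 := ℋ) (h36 := h37ℋ.toProp36Hypotheses)).act j g).hom.vertexMap (x j))) ≤ N)
    (hbddℋ : ∀ (C : Subgroup (ℋ.temperedPiChart h37ℋ.toProp36Hypotheses).G), IsCompact (C : Set (ℋ.temperedPiChart h37ℋ.toProp36Hypotheses).G) → C ≠ ⊥ →
      ∀ x x' : ∀ j, ((verticialLevelData_temperedPiChart (𝒢 := ℋ) (h36 := h37ℋ.toProp36Hypotheses)).tree j).Vertex,
      (∀ ⦃i j : ℕ⦄ (hij : i ≤ j), ((verticialLevelData_temperedPiChart (𝒢 := ℋ) (h36 := h37ℋ.toProp36Hypotheses)).trans hij).vertexMap (x j) = x i) →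
      (∀ ⦃i j : ℕ⦄ (hij : i ≤ j), ((verticialLevelData_temperedPiChart (𝒢 := ℋ) (h36 := h37ℋ.toProp36Hypotheses)).trans hij).vertexMap (x' j) = x' i) →
      (∀ g ∈ C, ∀ j, ((verticialLevelData_temperedPiChart (𝒢 := ℋ) (h36 := h37ℋ.toProp36Hypotheses)).act j g).hom.vertexMap (x j) = x j) →
      (∀ g ∈ C, ∀ j, ((verticialLevelData_temperedPiChart (𝒢 := ℋ) (h36 := h37ℋ.toProp36Hypotheses)).act j g).hom.vertexMap (x' j) = x' j) →
      ∃ N : ℕ, ∀ j, ((verticialLevelData_temperedPiChart (𝒢 := ℋ) (h36 := h37ℋ.toProp36Hypotheses)).tree j).subdivision.dist (Sum.inl (x j)) (Sum.inl (x' j)) ≤ N)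
    (h𝒢 : Cor39Hypotheses 𝒢) (hℋ : Cor39Hypotheses ℋ) (c𝒢 : TemperedPiChart 𝒢) (cℋ : TemperedPiChart ℋ) :
    (∀ (F : Hom 𝒢 ℋ), F.IsLocallyOpen → ∀ φ : c𝒢.G →ₜ* cℋ.G,
        (∃ θ : F.ConjugatorFamily, Nonempty (F.chartPullbackWith θ c𝒢 cℋ ≅ BTemp.res φ)) →
          IsCompatiblyQuasiGeometric φ) ∧
      ∀ φ : c𝒢.G →ₜ* cℋ.G, IsCompatiblyQuasiGeometric φ →
        ∃ F : Hom 𝒢 ℋ, F.IsLocallyOpen ∧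
          (∃ θ : F.ConjugatorFamily, Nonempty (F.chartPullbackWith θ c𝒢 cℋ ≅ BTemp.res φ)) ∧
          ∀ F' : Hom 𝒢 ℋ, F'.IsLocallyOpen →
            (∃ θ' : F'.ConjugatorFamily, Nonempty (F'.chartPullbackWith θ' c𝒢 cℋ ≅ BTemp.res φ)) →
              F'.base.vertexMap = F.base.vertexMap ∧ F'.base.edgeMap = F.base.edgeMap :=
  cor39UpToTwistAt (compactInVerticialAt_of_noEscape h37𝒢 hdisp𝒢 hbdd𝒢)
    (compactInVerticialAt_of_noEscape h37ℋ hdispℋ hbddℋ) h𝒢 hℋ c𝒢 cℋ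

end ProfiniteSemiGraph

end Literature.AnabelianGeometry.SemiGraphs
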